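import Summits.CriticalPhenomena.Ising3DConformalLimit.Theorems.CanonicalBranchRefutationCanonicalDimensionIsWick
import HarnessLib

/-!
# Route `CanonicalBranchRefutation`: the support item `CanonicalHarmonicity` as a corollary

THEOREM-ONLY file.  With the crux `CanonicalDimensionIsWick` proved
(`CanonicalDimensionIsWick_of_stubs`), the route's support item `CanonicalHarmonicity`
(stmt-CriticalPhenomena-15524, harmonicity of the UNSYMMETRISED slice `y ↦ S₄(y, X)` off `X`)
follows: by the crux `U₄ ≡ 0`, so off the poles the slice IS the Wick sum `Σⱼ wⱼ‖y - Xⱼ‖⁻¹`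
(two-point law `S₂ = A‖·‖⁻¹`), a finite sum of Coulomb tails, harmonic off `X`
(`harmonicAt_const_mul_norm_sub_inv`).  (The other support item `HarmonicPairSandwichIsWick`,
stmt-CriticalPhenomena-15525, is verbatim the landed stub `stub_harmonicPairSandwichIsWick`.)
-/

noncomputable section

namespace Summit.CriticalPhenomena.Ising3DConformalLimit.Cruxes.CanonicalDimensionIsWick.Birth

open Literature.Probability.LatticeModels
open Literature.MathematicalPhysics.QuantumFieldTheory (IsReflectionPositiveAlong)
open Summit.CriticalPhenomena.Ising3DConformalLimit.Theses.CanonicalBranchRefutation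
open Filter Set Function InnerProductSpace
open scoped Topology BigOperators

/-- **Support item `CanonicalHarmonicity` (stmt-CriticalPhenomena-15524), PROVED as a corollary of
the crux**: under the crux hypotheses `U₄ ≡ 0` (`CanonicalDimensionIsWick_of_stubs`), so for an
injective triple `X` the slice `y ↦ S₄(y, X)` agrees near every `y₀ ∉ range X` with the Wick sum
`Σⱼ wⱼ ‖y - Xⱼ‖⁻¹` (two-point law `S₂ = A‖·‖⁻¹`, `exists_amplitude`), a sum of Coulomb tails
harmonic off the poles. -/
theorem CanonicalHarmonicity_proof : CanonicalHarmonicity := by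
  intro S hlim hos hgks hleb hnd hM X hXinj y₀ hy₀
  have hU := CanonicalDimensionIsWick_of_stubs S hlim hos hgks hleb hnd hM
  obtain ⟨A, _, htp⟩ := exists_amplitude hnd hM
  -- the open set off the poles
  have hopen : IsOpen (Set.range X)ᶜ := (Set.finite_range X).isClosed.isOpen_compl
  -- the Wick sum as a function of the head point
  have hW : ∀ y ∉ Set.range X, S 4 (Fin.cons y X) =
      A * S 2 ![X 1, X 2] * ‖y - X 0‖⁻¹ + A * S 2 ![X 0, X 2] * ‖y - X 1‖⁻¹ +
        A * S 2 ![X 0, X 1] * ‖y - X 2‖⁻¹ := by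
    intro y hy
    have hy' : ∀ j, y ≠ X j := fun j h => hy ⟨j, h.symm⟩
    have hmem : (Fin.cons y X : Fin 4 → EuclideanSpace ℝ (Fin 3)) ∈ NonCoincident 3 4 :=
      (mem_nonCoincident _).2 (Fin.cons_injective_iff.2 ⟨hy, hXinj⟩)
    have h0 := hU _ hmem
    unfold limitConnectedFour at h0
    have ev0 : (Fin.cons y X : Fin 4 → EuclideanSpace ℝ (Fin 3)) 0 = y := rfl
    have ev1 : (Fin.cons y X : Fin 4 → EuclideanSpace ℝ (Fin 3)) 1 = X 0 := rfl
    have ev2 : (Fin.cons y X : Fin 4 → EuclideanSpace ℝ (Fin 3)) 2 = X 1 := rfl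
    have ev3 : (Fin.cons y X : Fin 4 → EuclideanSpace ℝ (Fin 3)) 3 = X 2 := rfl
    rw [ev0, ev1, ev2, ev3, htp y (X 0) (hy' 0), htp y (X 1) (hy' 1), htp y (X 2) (hy' 2)] at h0
    linarith
  have hmem₀ : y₀ ∈ (Set.range X)ᶜ := hy₀
  have hev : (fun y => S 4 (Fin.cons y X)) =ᶠ[𝓝 y₀] fun y =>
      A * S 2 ![X 1, X 2] * ‖y - X 0‖⁻¹ + A * S 2 ![X 0, X 2] * ‖y - X 1‖⁻¹ +
        A * S 2 ![X 0, X 1] * ‖y - X 2‖⁻¹ := by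
    filter_upwards [hopen.mem_nhds hmem₀] with y hy using hW y hy
  rw [harmonicAt_congr_nhds hev]
  have hy' : ∀ j, y₀ ≠ X j := fun j h => hy₀ ⟨j, h.symm⟩
  have h0 := harmonicAt_const_mul_norm_sub_inv (A * S 2 ![X 1, X 2]) (hy' 0)
  have h1 := harmonicAt_const_mul_norm_sub_inv (A * S 2 ![X 0, X 2]) (hy' 1)
  have h2 := harmonicAt_const_mul_norm_sub_inv (A * S 2 ![X 0, X 1]) (hy' 2)
  have h := (h0.add h1).add h2
  exact h

end Summit.CriticalPhenomena.Ising3DConformalLimit.Cruxes.CanonicalDimensionIsWick.Birth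

end
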